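import Summits.Ventures.Crystal3D.Theorems.StickyWulffConstantCoaxialWallLawOnSiteDominateMenuTwin
import Summits.Ventures.Crystal3D.Theorems.StickyWulffConstantCoaxialWallLawEndRowCoaxialModuleMenu
import Summits.Ventures.Crystal3D.Theorems.StickyWulffConstantCoaxialWallLawEndRowOuterShellSig
import Summits.Ventures.Crystal3D.Theorems.StickyWulffConstantCoaxialWallLawOnSiteCapstone
import HarnessLib

/-!
# THE 𝒰_cx BRIDGE AND CAPSTONE: the coaxial-module certificate bounds every module payer window; the crux from it and the OFF-MODULE tails
# (crux `CoaxialWallLaw`, stmt-Ventures-19481, line `WallLedgerF`)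

HONEST FRAMING. Venture `Summits/Ventures/Crystal3D` (cell `crystal3d-full`), helper `--supports` the crux
`CoaxialWallLaw` (stmt-Ventures-19481, `route-Ventures-StickyWulffConstant`), REGISTERED line `WallLedgerF` (planner
cf-p1).  Rung credit; F-C1 NOT moved.  DECISION (lxii) 2026-08-28T23:54:54Z: the non-Barlow coaxial universe of record is
19481-p1's COAXIAL-MODULE universe `coaxialModuleUniverse` (𝒰_cx, `…EndRowCoaxialModuleDefs`: finite `1`-separated
subsets of the module `coaxialModule 1 √(2/3)` inside `B̄(0,3]`, payer `0`, `deg 0 ≤ 11`); the certificate of record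
becomes `EndRowOnSiteFlatA v2 (9/2) coaxialModuleUniverse` (B&B with exclusion constraints, ALL sites free) and the
tails become the OFF-MODULE payer windows.  This file is the re-based capstone cf-p1 asked for, «same proof shape as
p678190»:
* `localSummandA_trans/twin_le_of_onSiteA_menu`, `endRowTransA/TwinHalfTurnA_of_onSiteA_menu` — the bridge of
  `…OnSiteBridge` for ANY universe of patterns inside a set `W` with the eighteen-vector neighbour menu
  (`…OnSiteDominateMenu/Twin`, `…MenuWindowFrames`);
* `coaxialModule_menu` — the module has the menu (19481-p1's `coaxialModule_neighbour_mem`);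
  `endRowOnSiteA_cx_of_flat` — on 𝒰_cx the flat certificate implies the plain on-site fact for the SAME pattern
  (19481-p1's `endRowOnSiteA_of_endRowOnSiteFlatA`; the far-slot hypothesis is the fourth clause of `IsTwinReading`, no
  site geometry — cf. `far_slot_not_site_barlow`, which has no module analogue);
* `endRowTransA_of_onSiteFlatA_cx`, `endRowTwinHalfTurnA_of_onSiteFlatA_cx`, `coaxialWallLaw_of_onSiteFlatA_cx_certified`;
* **`coaxialWallLaw_of_onSiteFlatA_v2A_nineHalves_cx : P5Exhaustion → EndRowOnSiteFlatA v2 (9/2) coaxialModuleUniverse →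
  EndRowTwinTailA v2 (9/2) coaxialModuleUniverse → EndRowTransTailA v2 (9/2) coaxialModuleUniverse → CoaxialWallLaw`** —
  THE LANE-F CAPSTONE OF RECORD after (lxii);
* `endRowTransTailA_mono` / `endRowTwinTailA_mono` — tails are monotone in the universe, so the Barlow-universe tails
  imply the 𝒰_cx tails (`barlowWindowUniverseAll ⊆ coaxialModuleUniverse`), and the landed Barlow capstone stays a
  special case.
REMAINING BY-NAME DEBTS of lane F after this file: `P5Exhaustion` · `EndRowOnSiteFlatA v2 (9/2) coaxialModuleUniverse`
[computational, bnb-ucx] · the two OFF-MODULE tails.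
WHAT THIS IS NOT: not the certificate, not the tails; F-C1 not moved.
-/

noncomputable section

namespace Summit.Ventures.Crystal3D.Theorems

open Summit.Ventures.Crystal3D Finset
open Literature.MathematicalPhysics.StatisticalMechanics (basalMirror)
open scoped InnerProductSpace

/-! ### Tails are monotone in the universe -/

/-- A window on-site for `𝒰` is on-site for every larger universe. -/
theorem onSiteAt_mono {𝒰 𝒰' : Set (Finset (EuclideanSpace ℝ (Fin 3)))} (h : 𝒰 ⊆ 𝒰')
    {X : Finset (EuclideanSpace ℝ (Fin 3))} {z : EuclideanSpace ℝ (Fin 3)} (hon : OnSiteAt 𝒰 X z) : OnSiteAt 𝒰' X z := by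
  obtain ⟨P, hP, S, hS⟩ := hon
  exact ⟨P, h hP, S, hS⟩

/-- The translation tail over a larger universe is weaker. -/
theorem endRowTransTailA_mono {v : WordVersion} {sF : ℝ} {𝒰 𝒰' : Set (Finset (EuclideanSpace ℝ (Fin 3)))} (h : 𝒰 ⊆ 𝒰')
    (ht : EndRowTransTailA v sF 𝒰) : EndRowTransTailA v sF 𝒰' :=
  fun L X hX z hz hdeg hoff => ht L X hX z hz hdeg fun hon => hoff (onSiteAt_mono h hon)

/-- The twin tail over a larger universe is weaker. -/
theorem endRowTwinTailA_mono {v : WordVersion} {sF : ℝ} {𝒰 𝒰' : Set (Finset (EuclideanSpace ℝ (Fin 3)))} (h : 𝒰 ⊆ 𝒰')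
    (ht : EndRowTwinTailA v sF 𝒰) : EndRowTwinTailA v sF 𝒰' :=
  fun L X hX z hz hdeg hoff => ht L X hX z hz hdeg fun hon => hoff (onSiteAt_mono h hon)

/-! ### The bridge for any universe inside a menu set -/

section MenuBridge

variable {v : WordVersion} {sF : ℝ} {𝒰 : Set (Finset (EuclideanSpace ℝ (Fin 3)))} {W : Set (EuclideanSpace ℝ (Fin 3))}

open scoped Classical in
/-- **Bridge, translation row**: at a payer window on-site for a universe of patterns inside a menu set `W`, the
typed translation summand is `≤ s_F` for every frame, given the on-site fact on `𝒰`. -/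
theorem localSummandA_trans_le_of_onSiteA_menu
    (hW : ∀ q ∈ W, ∀ x ∈ W, dist q x = 1 →
      x - q ∈ fccSlots ∨ x - q ∈ (basalMirror : EuclideanSpace ℝ (Fin 3) → EuclideanSpace ℝ (Fin 3)) '' ↑fccSlots)
    (h𝒰 : ∀ P ∈ 𝒰, ∀ p ∈ P, p ∈ W) (hon : EndRowOnSiteA v sF 𝒰)
    (L : EuclideanSpace ℝ (Fin 3) ≃ₗᵢ[ℝ] EuclideanSpace ℝ (Fin 3))
    {X : Finset (EuclideanSpace ℝ (Fin 3))} {z : EuclideanSpace ℝ (Fin 3)} (hsite : OnSiteAt 𝒰 X z) :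
    localSummandA v ⟨L, inPlaneRoots L 1⟩ ⟨L, inPlaneRoots L (-1)⟩ X z ≤ sF := by
  obtain ⟨P, hP, S, hwin⟩ := hsite
  obtain ⟨ε, n, hn, hle⟩ := exists_transSig_bound_menu (v := v) hW S (onSite_window_agree hwin) (h𝒰 P hP) L
  exact hle.trans ((hon P hP).1 ε n hn)

open scoped Classical in
/-- **Bridge, twin row** (half-turn form). -/
theorem localSummandA_twin_le_of_onSiteA_menu
    (hW : ∀ q ∈ W, ∀ x ∈ W, dist q x = 1 →
      x - q ∈ fccSlots ∨ x - q ∈ (basalMirror : EuclideanSpace ℝ (Fin 3) → EuclideanSpace ℝ (Fin 3)) '' ↑fccSlots)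
    (h𝒰 : ∀ P ∈ 𝒰, ∀ p ∈ P, p ∈ W) (hon : EndRowOnSiteA v sF 𝒰)
    (L : EuclideanSpace ℝ (Fin 3) ≃ₗᵢ[ℝ] EuclideanSpace ℝ (Fin 3))
    {X : Finset (EuclideanSpace ℝ (Fin 3))} {z : EuclideanSpace ℝ (Fin 3)} (hsite : OnSiteAt 𝒰 X z) :
    localSummandA v ⟨L, inPlaneRoots L 1⟩
      ⟨((ℝ ∙ EuclideanSpace.single (2 : Fin 3) (1 : ℝ)).reflection).trans L,
        inPlaneRoots (((ℝ ∙ EuclideanSpace.single (2 : Fin 3) (1 : ℝ)).reflection).trans L) (-1)⟩ X z ≤ sF := by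
  obtain ⟨P, hP, S, hwin⟩ := hsite
  rcases exists_twinSig_bound_menu (v := v) hW S (onSite_window_agree hwin) (h𝒰 P hP) L with
    ⟨ε, n, hn, hle⟩ | ⟨ε, h, hh, hle⟩
  · exact hle.trans ((hon P hP).1 ε n hn)
  · exact hle.trans ((hon P hP).2 ε h hh)

/-- **`EndRowTransA` from the on-site fact on `𝒰 ⊆ 𝒫(W)` and the translation tail over `𝒰`.** -/
theorem endRowTransA_of_onSiteA_menu
    (hW : ∀ q ∈ W, ∀ x ∈ W, dist q x = 1 →
      x - q ∈ fccSlots ∨ x - q ∈ (basalMirror : EuclideanSpace ℝ (Fin 3) → EuclideanSpace ℝ (Fin 3)) '' ↑fccSlots)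
    (h𝒰 : ∀ P ∈ 𝒰, ∀ p ∈ P, p ∈ W) (hon : EndRowOnSiteA v sF 𝒰) (htail : EndRowTransTailA v sF 𝒰) :
    EndRowTransA v sF :=
  endRowTransA_of_onSite_of_tail 𝒰 (fun L _ _ _ _ _ hsite => localSummandA_trans_le_of_onSiteA_menu hW h𝒰 hon L hsite)
    htail

/-- **`EndRowTwinHalfTurnA` from the on-site fact on `𝒰 ⊆ 𝒫(W)` and the twin tail over `𝒰`.** -/
theorem endRowTwinHalfTurnA_of_onSiteA_menu
    (hW : ∀ q ∈ W, ∀ x ∈ W, dist q x = 1 →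
      x - q ∈ fccSlots ∨ x - q ∈ (basalMirror : EuclideanSpace ℝ (Fin 3) → EuclideanSpace ℝ (Fin 3)) '' ↑fccSlots)
    (h𝒰 : ∀ P ∈ 𝒰, ∀ p ∈ P, p ∈ W) (hon : EndRowOnSiteA v sF 𝒰) (htail : EndRowTwinTailA v sF 𝒰) :
    EndRowTwinHalfTurnA v sF :=
  endRowTwinHalfTurnA_of_onSite_of_tail 𝒰
    (fun L _ _ _ _ _ hsite => localSummandA_twin_le_of_onSiteA_menu hW h𝒰 hon L hsite) htail

end MenuBridge

/-! ### The coaxial-module instance -/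

/-- The coaxial module (ideal spacings) has the eighteen-vector neighbour menu (19481-p1's `coaxialModule_neighbour_mem`). -/
theorem coaxialModule_menu : ∀ q ∈ coaxialModule 1 (Real.sqrt (2 / 3)), ∀ x ∈ coaxialModule 1 (Real.sqrt (2 / 3)),
    dist q x = 1 →
      x - q ∈ fccSlots ∨ x - q ∈ (basalMirror : EuclideanSpace ℝ (Fin 3) → EuclideanSpace ℝ (Fin 3)) '' ↑fccSlots :=
  fun _ hq _ hx hd => coaxialModule_neighbour_mem hq hx hd

/-- Patterns of 𝒰_cx lie on the module. -/
theorem mem_coaxialModule_of_mem_universe {P : Finset (EuclideanSpace ℝ (Fin 3))} (hP : P ∈ coaxialModuleUniverse) :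
    ∀ p ∈ P, p ∈ coaxialModule 1 (Real.sqrt (2 / 3)) :=
  fun _ hp => (hP.1 (mem_coe.2 hp)).1

/-- **On 𝒰_cx the flat certificate implies the plain on-site fact** (same pattern; far slots by `IsTwinReading`'s own
fourth clause). -/
theorem endRowOnSiteA_cx_of_flat {v : WordVersion} {sF : ℝ} (hon : EndRowOnSiteFlatA v sF coaxialModuleUniverse) :
    EndRowOnSiteA v sF coaxialModuleUniverse :=
  endRowOnSiteA_of_endRowOnSiteFlatA (fun _ hP => ⟨hP.2.2.1, hP.2.2.2⟩) hon

section Cx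

variable {v : WordVersion} {sF : ℝ}

/-- **`EndRowTransA` from the 𝒰_cx flat certificate and the OFF-MODULE translation tail.** -/
theorem endRowTransA_of_onSiteFlatA_cx (hon : EndRowOnSiteFlatA v sF coaxialModuleUniverse)
    (htail : EndRowTransTailA v sF coaxialModuleUniverse) : EndRowTransA v sF :=
  endRowTransA_of_onSiteA_menu coaxialModule_menu (fun _ hP => mem_coaxialModule_of_mem_universe hP)
    (endRowOnSiteA_cx_of_flat hon) htail

/-- **`EndRowTwinHalfTurnA` from the 𝒰_cx flat certificate and the OFF-MODULE twin tail.** -/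
theorem endRowTwinHalfTurnA_of_onSiteFlatA_cx (hon : EndRowOnSiteFlatA v sF coaxialModuleUniverse)
    (htail : EndRowTwinTailA v sF coaxialModuleUniverse) : EndRowTwinHalfTurnA v sF :=
  endRowTwinHalfTurnA_of_onSiteA_menu coaxialModule_menu (fun _ hP => mem_coaxialModule_of_mem_universe hP)
    (endRowOnSiteA_cx_of_flat hon) htail

end Cx

/-! ### The capstone -/

/-- **The crux from `P5Exhaustion`, the 𝒰_cx flat certificate and the two off-module tails**, any version and constant
`0 < s_F ≤ 2√6`, kissing facts certified. -/
theorem coaxialWallLaw_of_onSiteFlatA_cx_certified (ver : WordVersion) (hE1 : P5Exhaustion) {sF : ℝ} (hsF : 0 < sF)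
    (hsF' : sF ≤ 2 * Real.sqrt 6) (hon : EndRowOnSiteFlatA ver sF coaxialModuleUniverse)
    (htailW : EndRowTwinTailA ver sF coaxialModuleUniverse) (htailT : EndRowTransTailA ver sF coaxialModuleUniverse) :
    Summit.Ventures.Crystal3D.Theses.StickyWulffConstant.CoaxialWallLaw :=
  coaxialWallLaw_of_twoRowsA_certified ver hE1 hsF hsF' (endRowTwinHalfTurnA_of_onSiteFlatA_cx hon htailW)
    (endRowTransA_of_onSiteFlatA_cx hon htailT)

/-- **THE LANE-F CAPSTONE OF RECORD after (lxii): `(v2(A), r = 1)`, `s_F* = 9/2`, certificate universe 𝒰_cx (coaxial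
module windows, all sites free), tails = OFF-MODULE payer windows.** -/
theorem coaxialWallLaw_of_onSiteFlatA_v2A_nineHalves_cx (hE1 : P5Exhaustion)
    (hon : EndRowOnSiteFlatA WordVersion.v2 (9 / 2) coaxialModuleUniverse)
    (htailW : EndRowTwinTailA WordVersion.v2 (9 / 2) coaxialModuleUniverse)
    (htailT : EndRowTransTailA WordVersion.v2 (9 / 2) coaxialModuleUniverse) :
    Summit.Ventures.Crystal3D.Theses.StickyWulffConstant.CoaxialWallLaw :=
  coaxialWallLaw_of_onSiteFlatA_cx_certified WordVersion.v2 hE1 (by norm_num) nine_halves_le_two_sqrt_six hon htailW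
    htailT

/-- Sanity: the Barlow-universe tails imply the 𝒰_cx tails (monotonicity), so the new capstone also consumes the old
tail hypotheses together with the larger certificate. -/
theorem coaxialWallLaw_of_onSiteFlatA_cx_of_barlowTails (hE1 : P5Exhaustion)
    (hon : EndRowOnSiteFlatA WordVersion.v2 (9 / 2) coaxialModuleUniverse)
    (htailW : EndRowTwinTailA WordVersion.v2 (9 / 2) barlowWindowUniverseAll)
    (htailT : EndRowTransTailA WordVersion.v2 (9 / 2) barlowWindowUniverseAll) :
    Summit.Ventures.Crystal3D.Theses.StickyWulffConstant.CoaxialWallLaw :=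
  coaxialWallLaw_of_onSiteFlatA_v2A_nineHalves_cx hE1 hon
    (endRowTwinTailA_mono barlowWindowUniverseAll_subset_coaxialModuleUniverse htailW)
    (endRowTransTailA_mono barlowWindowUniverseAll_subset_coaxialModuleUniverse htailT)

end Summit.Ventures.Crystal3D.Theorems

end
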